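import Summits.CriticalPhenomena.PercolationContinuityZ3.Theorems.PercNearOneGluingNoHeavyLowerTailFKClusterTreeHarris
import Summits.CriticalPhenomena.PercolationContinuityZ3.Theorems.PercNearOneGluingNoHeavyLowerTailFKHullPortPvTools
import Summits.CriticalPhenomena.PercolationContinuityZ3.Theorems.PercNearOneGluingNoHeavyLowerTailFKHullPortTAInduction
import HarnessLib

/-!
# FK sub-lane: Lemma `P_v` for `φ_{𝐩,q}` and the unconditional `T_A^{FK} ≥ 0`, `Δ_N^{FK} ≥ 0`

Support file (`--supports stmt-CriticalPhenomena-4575`), FK sub-lane `prim-bschramm-fk-2` (gen 3); builds on p205010 (kernel theorem,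
internal audit signed; external expert review pending).  No definitions, no named facts, no sorries; standard axioms.

* `FK.taB_singleton_le` — prim-hp-7's Lemma `P_v` (HP7-MDLX-PROOF §1, §6) for the random-cluster measure `φ_{u,q}`, `q ≥ 1`,
  in the sum form used as hypothesis `hPv` by `FK.taQ_nonneg_of_Pv` / `FK.deltaN_nonneg_of_Pv`: for an increasing family `U`
  of edge sets, `s ≠ y` and any `v`,
  `B(u, {v}) ≤ Z_u · (1 − φ(s ↮ y, y ↔ v)/φ(s ↮ y)) · Cov_u(1_U(C_s), 1{s ↔ y})`.
  Proof (bschramm/FK-Q2.md §12.3): the world covariance on `{v ↮ s}` is the conditional covariance given the class `{C_v = W}`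
  (`FK.taC_singleton_indicator_eq`); summing, `B(u,{v})/Z = φ(A ∩ Y) − Σ_ω φ{ω} φ(A | E_ω) φ(Y | E_ω)` (reindexing,
  `FK.sum_rcMass_mul_condProb`); with `F = {s ↔ y} ∪ {y ↔ v}` increasing and `1_Y = 1_F − 1{y ↔ v, s ↮ y}` classwise, the
  cluster-conditional Harris inequality `FK.clusterHarris_rc` bounds the `F`-part by `φ(A)φ(F)` and the CPA step
  `FK.real_clusterEvent_openConn_notConn_mul_le` bounds the remainder.
* `FK.taQ_nonneg_ind`, `FK.deltaN_nonneg_ind` — the now unconditional `T_A^{FK} ≥ 0` and located FK lemma `(Δ)` for indicator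
  test functions `1_U`, `U` increasing (`FK.taQ_nonneg_of_Pv`, `FK.deltaN_nonneg_of_Pv` with `hPv` discharged).
[cite: Gladkov2024, Thm. 3.2 (p. 4)] [cite: VandenbergHaggstromKahn2005, Thm. 1.3 (p. 6), §2.1 Lemmas 2.3–2.4 (p. 10)]
[cite: Grimmett2006, Thm. (3.8)(b) (p. 39), (2.17)]
-/

noncomputable section

namespace Summit.CriticalPhenomena.PercolationContinuityZ3.Theorems.FK

open MeasureTheory Set
open Literature.Probability.LatticeModels Literature.Probability.Percolation
open Literature.Probability.Percolation.DecisionTree (ind ind_of_mem ind_of_not_mem ind_nonneg)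
open Literature.Probability.Percolation.BHK2006 (rcMass rcMass_nonneg sum_rcMass delW setCl barOf rcMass_fkg
  integral_rcMeasureW_eq_sum rcMeasureW_real_eq_sum_rcMass setCl_eq_sdiff_barOf openEdgeCluster_mono ind_inter setCl_mono
  delW_anti barOf_mono sum_rcMass_mono_weights rc_set_sum_cond_cluster setIntegral_rcMeasureW_eq_sum)
open Literature.Probability.Percolation.KNPreFKG
open Summit.CriticalPhenomena.PercolationContinuityZ3.Theorems.HullPort (cut avoidEv cut_eq_barOf)
open scoped Classical

variable {V : Type*} [Fintype V]

/-! ### Lemma `P_v` -/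

/-- **Prim-hp-7's Lemma `P_v` for the random-cluster measure `φ_{𝐩,q}`, `q ≥ 1`, in sum form** (the hypothesis `hPv` of
`FK.taQ_nonneg_of_Pv` / `FK.deltaN_nonneg_of_Pv`, for the indicator of an upper family `U`): for all weights `u`, vertices `s ≠ y`, `v`,
  `B(u, {v}) ≤ Z_u · (1 − φ(s↮y, y↔v)/φ(s↮y)) · Cov_u(1_U(C_s), 1{s↔y})`,
i.e. `E[Cov(1_U(C_s), 1{s↔y} | σ(C_v))] ≤ φ(y↮v | y↮s)·Cov(1_U(C_s), 1{s↔y})` — "conditioning on the cluster of `v` explains at least the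
fraction `φ(y↔v | y↮s)` of the covariance" (HP7-MDLX-PROOF §1).  Proof = prim-hp-7's: the cluster-conditional Harris inequality
(`FK.clusterHarris_rc`) for `A = {C_s ∈ U}` and `F = {y ∈ C_s ∪ C_v}`, the identity `1{s↔y} = 1_F − 1{y↔v, s↮y}` on each class
`{C_v = W}`, and the conditional positive association of `C_s` given `{s ↮ y}` (vdBHK Thm 1.3 for `φ_{𝐩,q}`,
`BHK2006_clusterConditionalPositiveAssociation_rc`) against the decreasing world probability `φ_{G − C̄_s}(y ↔ v)`; the world terms are
identified by vdBHK's Lemma 2.3 for `φ_{𝐩,q}` (`BHK2006_rcMeasureW_real_setCl_inter`, `rc_set_sum_cond_cluster`).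
[cite: Gladkov2024, Thm. 3.2 (p. 4)] [cite: VandenbergHaggstromKahn2005, Thm. 1.3 (p. 6), §2.1 Lemmas 2.3–2.4 (p. 10)]
[cite: Grimmett2006, Thm. (3.8)(b)] -/
theorem taB_singleton_le (u : Sym2 V → unitInterval) {q : ℝ} (hq : 1 ≤ q) {s y : V} (hsy : s ≠ y) (v : V)
    (U : Set (Set (Sym2 V))) (hU : IsUpperSet U) :
    taB u q s y {v} (U.indicator 1) ≤ rcPartitionFunctionW u q ∅ *
      ((1 - wE u q ∅ (ind ((openConn s y : Set (BondConfig V))ᶜ ∩ openConn y v)) /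
            wE u q ∅ (ind (openConn s y : Set (BondConfig V))ᶜ)) *
        (wE u q ∅ (fun η => U.indicator 1 (openEdgeCluster η s) * ind (openConn s y) η) -
          wE u q ∅ (fun η => U.indicator 1 (openEdgeCluster η s)) * wE u q ∅ (ind (openConn s y)))) := by
  classical
  have hq0 : 0 < q := one_pos.trans_le hq
  haveI := isProbabilityMeasure_rcMeasureW u hq0 (∅ : Set V)
  have hZpos : 0 < rcPartitionFunctionW u q ∅ := rcPartitionFunctionW_pos u hq0 ∅
  set A : Set (BondConfig V) := {ω | openEdgeCluster ω s ∈ U} with hA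
  set Y : Set (BondConfig V) := openConn s y with hY
  set N : Set (BondConfig V) := (openConn s y : Set (BondConfig V))ᶜ with hN
  set Vv : Set (BondConfig V) := openConn y v with hVv
  set E : BondConfig V → Set (BondConfig V) := fun ω => {ζ | openEdgeCluster ζ v = openEdgeCluster ω v} with hE
  have hmeas : ∀ S : Set (BondConfig V), MeasurableSet S := fun _ => MeasurableSet.of_discrete
  have hn := fun (S : Set (BondConfig V)) => (measureReal_nonneg : 0 ≤ (rcMeasureW u q ∅).real S)
  -- the indicator of `U` composed with `C_s` is the indicator of `A`
  have hgA : ∀ η : BondConfig V, U.indicator (1 : Set (Sym2 V) → ℝ) (openEdgeCluster η s) = ind A η :=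
    indicator_one_openEdgeCluster U s
  -- world expectations as `φ`-probabilities
  have hwE : ∀ (S : Set (BondConfig V)), wE u q ∅ (ind S) = (rcMeasureW u q ∅).real S := by
    intro S; unfold wE; rw [delW_empty, rcMeasureW_real_eq_sum_rcMass u hq0]
  have hwE2 : wE u q ∅ (fun η => U.indicator 1 (openEdgeCluster η s) * ind Y η) = (rcMeasureW u q ∅).real (A ∩ Y) := by
    unfold wE; rw [delW_empty, rcMeasureW_real_eq_sum_rcMass u hq0]
    refine Finset.sum_congr rfl fun η _ => ?_
    simp only [hgA, ind_inter]
  have hwE3 : wE u q ∅ (fun η => U.indicator 1 (openEdgeCluster η s)) = (rcMeasureW u q ∅).real A := by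
    unfold wE; rw [delW_empty, rcMeasureW_real_eq_sum_rcMass u hq0]
    refine Finset.sum_congr rfl fun η _ => ?_
    simp only [hgA]
  simp only [hwE, hwE2, hwE3]
  -- Cov(A, Y) ≥ 0 (FKG)
  have hAup : IsUpperSet A := by
    intro ω ω' hle hω
    exact hU (openEdgeCluster_mono hle s) hω
  have hCov : 0 ≤ (rcMeasureW u q ∅).real (A ∩ Y) - (rcMeasureW u q ∅).real A * (rcMeasureW u q ∅).real Y := by
    have h := rcMass_fkg u hq (f := fun ω => ind A ω) (g := fun ω => ind Y ω) (monotone_ind_of_isUpperSet hAup)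
      (monotone_ind_of_isUpperSet (isUpperSet_openConn s y))
    rw [← rcMeasureW_real_eq_sum_rcMass u hq0, ← rcMeasureW_real_eq_sum_rcMass u hq0] at h
    have e1 : ∑ ω, rcMass u q ω * (ind A ω * ind Y ω) = (rcMeasureW u q ∅).real (A ∩ Y) := by
      rw [rcMeasureW_real_eq_sum_rcMass u hq0]
      refine Finset.sum_congr rfl fun ω _ => ?_
      rw [ind_inter]
    rw [e1] at h
    linarith
  -- trivial cases `v = s` and `v = y`
  by_cases hvs : v = s
  · subst hvs
    rw [taB_eq_zero_of_root_mem u q v y {v} (Set.mem_singleton v)]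
    have hNV : (rcMeasureW u q ∅).real (N ∩ Vv) = 0 := by
      have : N ∩ Vv = ∅ := by
        ext ω
        simp only [hN, hVv, openConn, Set.mem_inter_iff, Set.mem_compl_iff, Set.mem_setOf_eq, Set.mem_empty_iff_false, iff_false,
          not_and]
        intro h1 h2; exact h1 h2.symm
      rw [this, measureReal_empty]
    rw [hNV, zero_div, sub_zero, one_mul]
    exact mul_nonneg hZpos.le hCov
  by_cases hvy : v = y
  · subst hvy
    rw [taB_eq_zero_of_mem u q hsy {v} (Set.mem_singleton v)]
    by_cases hN0 : (rcMeasureW u q ∅).real N = 0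
    · rw [hN0, div_zero, sub_zero, one_mul]; exact mul_nonneg hZpos.le hCov
    · have hNV : (rcMeasureW u q ∅).real (N ∩ Vv) = (rcMeasureW u q ∅).real N := by
        congr 1; ext ω
        simp only [hVv, openConn, Set.mem_inter_iff, Set.mem_setOf_eq, and_iff_left_iff_imp]
        exact fun _ => SimpleGraph.Reachable.refl _
      rw [hNV, div_self hN0, sub_self, zero_mul, mul_zero]
  -- main case: `v ∉ {s, y}`
  set G : Set (BondConfig V) := {ω | ¬ (openGraph ω).Reachable v s} with hG
  set F : Set (BondConfig V) := Y ∪ Vv with hF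
  -- conditional probabilities
  set cp : Set (BondConfig V) → BondConfig V → ℝ := fun S ω => (rcMeasureW u q ∅).real (S ∩ E ω) / (rcMeasureW u q ∅).real (E ω) with hcp
  -- STEP 0/1/2: `B(u,{v}) = Z · Σ_ω φ{ω} [cp(A∩Y) − cp(A)·cp(Y)]`
  have hmass : ∀ ω, (rcMeasureW u q ∅).real {ω} = rcMass u q ω := fun ω => by
    rw [rcMeasureW_real_singleton u hq0]; rfl
  have hEpos : ∀ ω, rcMass u q ω ≠ 0 → 0 < (rcMeasureW u q ∅).real (E ω) := fun ω hne =>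
    rcMeasureW_real_clusterClass_pos u hq0 v hne
  -- on `G`, the world covariance is the conditional covariance given the class
  have hworld : ∀ ω, ω ∈ G → rcMass u q ω ≠ 0 →
      taC u q s y {v} (U.indicator 1) ω = cp (A ∩ Y) ω - cp A ω * cp Y ω := by
    intro ω hωG hne
    have h := taC_singleton_indicator_eq u hq0 (y := y) hvs U hωG hne
    simp only [hcp]
    exact h
  -- off `G`, `A` is constant on the class, so the conditional covariance vanishes
  have hconst : ∀ ω, ω ∉ G → rcMass u q ω ≠ 0 → cp (A ∩ Y) ω - cp A ω * cp Y ω = 0 := by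
    intro ω hωG hne
    have hEp := hEpos ω hne
    have hvs' : (openGraph ω).Reachable v s := by by_contra h; exact hωG h
    have hAcl : ∀ ζ, ζ ∈ E ω → (ζ ∈ A ↔ ω ∈ A) := by
      intro ζ hζ
      have hζ' : openEdgeCluster ζ v = openEdgeCluster ω v := hζ
      have hr : (openGraph ζ).Reachable v s := (reachable_iff_of_openEdgeCluster_eq hζ' s).2 hvs'
      simp only [hA, Set.mem_setOf_eq, UnionExchange.openEdgeCluster_eq_of_reachable hr, UnionExchange.openEdgeCluster_eq_of_reachable hvs', hζ']
    by_cases hωA : ω ∈ A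
    · have h1 : A ∩ Y ∩ E ω = Y ∩ E ω := by
        ext ζ; constructor
        · rintro ⟨⟨-, h2⟩, h3⟩; exact ⟨h2, h3⟩
        · rintro ⟨h2, h3⟩; exact ⟨⟨(hAcl ζ h3).2 hωA, h2⟩, h3⟩
      have h2 : A ∩ E ω = E ω := by
        ext ζ; constructor
        · rintro ⟨-, h3⟩; exact h3
        · intro h3; exact ⟨(hAcl ζ h3).2 hωA, h3⟩
      simp only [hcp, h1, h2, div_self hEp.ne']; ring
    · have h1 : A ∩ Y ∩ E ω = ∅ := by
        rw [Set.eq_empty_iff_forall_notMem]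
        rintro ζ ⟨⟨hζA, -⟩, hζE⟩; exact hωA ((hAcl ζ hζE).1 hζA)
      have h2 : A ∩ E ω = ∅ := by
        rw [Set.eq_empty_iff_forall_notMem]
        rintro ζ ⟨hζA, hζE⟩; exact hωA ((hAcl ζ hζE).1 hζA)
      simp only [hcp, h1, h2, measureReal_empty, zero_div]; ring
  have hBsum : taB u q s y {v} (U.indicator 1) = rcPartitionFunctionW u q ∅ * ∑ ω, rcMass u q ω * (cp (A ∩ Y) ω - cp A ω * cp Y ω) := by
    unfold taB
    rw [Finset.mul_sum]
    refine Finset.sum_congr rfl fun ω _ => ?_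
    have hrc : rcWeightW u q ∅ ω = rcPartitionFunctionW u q ∅ * rcMass u q ω := by
      unfold rcMass; field_simp
    rw [hrc]
    by_cases hne : rcMass u q ω = 0
    · rw [hne]; ring
    by_cases hωG : ω ∈ G
    · have hav : ω ∈ avoidEv s ({v} : Set V) := by
        intro t ht hst; rw [Set.mem_singleton_iff] at ht; subst ht; exact hωG hst.symm
      rw [ind_of_mem hav, one_mul, hworld ω hωG hne]; ring
    · have hav : ω ∉ avoidEv s ({v} : Set V) := by
        intro h; apply hωG; intro hr; exact h v (Set.mem_singleton v) hr.symm
      rw [ind_of_not_mem hav, zero_mul, mul_zero, hconst ω hωG hne]; ring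
  -- STEP 3/4: reindexing and the cluster-conditional Harris inequality
  have hsum1 : ∑ ω, rcMass u q ω * cp (A ∩ Y) ω = (rcMeasureW u q ∅).real (A ∩ Y) := by
    have h := sum_rcMass_mul_condProb u hq0 v (A ∩ Y) (fun _ => (1 : ℝ)) (fun _ _ _ => rfl)
    simp only [one_mul] at h
    rw [hcp]; simp only
    rw [h, ← rcMeasureW_real_eq_sum_rcMass u hq0]
  -- `1_Y = 1_F − 1_{Vv ∩ N}` and `Vv ∩ N` is a union of classes
  have hVN_class : ∀ ω ω' : BondConfig V, openEdgeCluster ω' v = openEdgeCluster ω v → (ω' ∈ Vv ∩ N ↔ ω ∈ Vv ∩ N) := by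
    intro ω ω' hζ
    have hr := reachable_iff_of_openEdgeCluster_eq hζ
    simp only [hVv, hN, openConn, Set.mem_inter_iff, Set.mem_compl_iff, Set.mem_setOf_eq]
    constructor
    · rintro ⟨h1, h2⟩
      have hvy : (openGraph ω).Reachable v y := (hr y).1 h1.symm
      refine ⟨hvy.symm, fun hsy' => h2 ?_⟩
      have hvs' : (openGraph ω').Reachable v s := (hr s).2 (hvy.trans hsy'.symm)
      exact hvs'.symm.trans h1.symm
    · rintro ⟨h1, h2⟩
      have hvy : (openGraph ω').Reachable v y := (hr y).2 h1.symm
      refine ⟨hvy.symm, fun hsy' => h2 ?_⟩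
      have hvs' : (openGraph ω).Reachable v s := (hr s).1 (hvy.trans hsy'.symm)
      exact hvs'.symm.trans h1.symm
  have hcpY : ∀ ω, rcMass u q ω ≠ 0 → cp Y ω = cp F ω - ind (Vv ∩ N) ω := by
    intro ω hne
    have hEp := hEpos ω hne
    have hFY : F ∩ E ω = (Y ∩ E ω) ∪ ((Vv ∩ N) ∩ E ω) := by
      ext ζ
      simp only [hF, hN, Set.mem_inter_iff, Set.mem_union, Set.mem_compl_iff]
      tauto
    have hdisj : Disjoint (Y ∩ E ω) ((Vv ∩ N) ∩ E ω) := by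
      rw [Set.disjoint_left]
      rintro ζ ⟨h1, -⟩ ⟨⟨-, h2⟩, -⟩
      exact h2 h1
    have hVNE : (rcMeasureW u q ∅).real ((Vv ∩ N) ∩ E ω) = ind (Vv ∩ N) ω * (rcMeasureW u q ∅).real (E ω) := by
      by_cases hω : ω ∈ Vv ∩ N
      · have : (Vv ∩ N) ∩ E ω = E ω := by
          ext ζ; constructor
          · rintro ⟨-, h⟩; exact h
          · intro h; exact ⟨(hVN_class ω ζ h).2 hω, h⟩
        rw [this, ind_of_mem hω, one_mul]
      · have : (Vv ∩ N) ∩ E ω = ∅ := by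
          rw [Set.eq_empty_iff_forall_notMem]
          rintro ζ ⟨h12, h3⟩; exact hω ((hVN_class ω ζ h3).1 h12)
        rw [this, ind_of_not_mem hω, measureReal_empty, zero_mul]
    simp only [hcp]
    rw [hFY, measureReal_union hdisj (hmeas _), hVNE]
    field_simp
    ring
  have hsum2 : ∑ ω, rcMass u q ω * (cp A ω * cp Y ω) =
      ∑ ω, rcMass u q ω * (cp A ω * cp F ω) - (rcMeasureW u q ∅).real (A ∩ (Vv ∩ N)) := by
    have h := sum_rcMass_mul_condProb u hq0 v A (fun ω => ind (Vv ∩ N) ω) (fun ω ω' hζ => by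
      by_cases hω : ω ∈ Vv ∩ N
      · rw [ind_of_mem hω, ind_of_mem ((hVN_class ω ω' hζ).2 hω)]
      · rw [ind_of_not_mem hω, ind_of_not_mem (fun h' => hω ((hVN_class ω ω' hζ).1 h'))])
    have e1 : ∑ ω, rcMass u q ω * (ind (Vv ∩ N) ω * ind A ω) = (rcMeasureW u q ∅).real (A ∩ (Vv ∩ N)) := by
      rw [rcMeasureW_real_eq_sum_rcMass u hq0]
      refine Finset.sum_congr rfl fun ω _ => ?_
      rw [ind_inter A (Vv ∩ N)]; ring
    rw [e1] at h
    rw [← h, ← Finset.sum_sub_distrib]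
    refine Finset.sum_congr rfl fun ω _ => ?_
    by_cases hne : rcMass u q ω = 0
    · rw [hne]; ring
    · rw [hcpY ω hne]
      simp only [hcp]
      ring
  have hHarris : (rcMeasureW u q ∅).real A * (rcMeasureW u q ∅).real F ≤ ∑ ω, rcMass u q ω * (cp A ω * cp F ω) := by
    have hFup : IsUpperSet F := IsUpperSet.union (isUpperSet_openConn s y) (isUpperSet_openConn y v)
    have h := clusterHarris_rc u hq ∅ v hAup hFup
    simp only [hmass] at h
    refine le_of_le_of_eq h ?_
    simp only [hcp]
    refine Finset.sum_congr rfl fun ω _ => ?_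
    ring
  -- STEP 5: conditional positive association of `C_s` given `{s ↮ y}` against the world probability of `{y ↔ v}`
  have hCPA : (rcMeasureW u q ∅).real (A ∩ (Vv ∩ N)) * (rcMeasureW u q ∅).real N ≤
      (rcMeasureW u q ∅).real (Vv ∩ N) * (rcMeasureW u q ∅).real (A ∩ N) :=
    real_clusterEvent_openConn_notConn_mul_le u hq s y v U hU
  -- STEP 6: assemble
  rw [hBsum]
  have hsplit : ∑ ω, rcMass u q ω * (cp (A ∩ Y) ω - cp A ω * cp Y ω) =
      (rcMeasureW u q ∅).real (A ∩ Y) - ∑ ω, rcMass u q ω * (cp A ω * cp F ω) + (rcMeasureW u q ∅).real (A ∩ (Vv ∩ N)) := by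
    rw [← hsum1]
    have : ∑ ω, rcMass u q ω * (cp (A ∩ Y) ω - cp A ω * cp Y ω) =
        ∑ ω, rcMass u q ω * cp (A ∩ Y) ω - ∑ ω, rcMass u q ω * (cp A ω * cp Y ω) := by
      rw [← Finset.sum_sub_distrib]; refine Finset.sum_congr rfl fun ω _ => ?_; ring
    rw [this, hsum2]; ring
  rw [hsplit]
  have hFsplit : (rcMeasureW u q ∅).real F = (rcMeasureW u q ∅).real Y + (rcMeasureW u q ∅).real (Vv ∩ N) := by
    have hFY : F = Y ∪ (Vv ∩ N) := by
      ext ζ; simp only [hF, hN, Set.mem_union, Set.mem_inter_iff, Set.mem_compl_iff]; tauto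
    have hdisj : Disjoint Y (Vv ∩ N) := by
      rw [Set.disjoint_left]; rintro ζ h1 ⟨-, h2⟩; exact h2 h1
    rw [hFY, measureReal_union hdisj (hmeas _)]
  have hVNN : Vv ∩ N = N ∩ Vv := Set.inter_comm _ _
  rw [← hVNN]
  -- `φ(A∩N) − φ(A)φ(N) = −Cov(A,Y)`
  have hAN : (rcMeasureW u q ∅).real (A ∩ N) = (rcMeasureW u q ∅).real A - (rcMeasureW u q ∅).real (A ∩ Y) := by
    have := measureReal_inter_add_sdiff (μ := rcMeasureW u q ∅) (s := A) (h := measure_ne_top _ _) (hmeas Y)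
    rw [show A \ Y = A ∩ N from by rw [hN, Set.sdiff_eq]] at this
    linarith
  have hNY : (rcMeasureW u q ∅).real N = 1 - (rcMeasureW u q ∅).real Y := by
    have := measureReal_compl (μ := rcMeasureW u q ∅) (hmeas Y)
    rw [probReal_univ] at this
    rw [hN, this]
  by_cases hN0 : (rcMeasureW u q ∅).real N = 0
  · -- then `φ(Vv ∩ N) = φ(A ∩ Vv ∩ N) = 0`
    have h1 : (rcMeasureW u q ∅).real (Vv ∩ N) = 0 := le_antisymm ((measureReal_mono Set.inter_subset_right (measure_ne_top _ _)).trans hN0.le) (hn _)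
    have h2 : (rcMeasureW u q ∅).real (A ∩ (Vv ∩ N)) = 0 :=
      le_antisymm ((measureReal_mono Set.inter_subset_right (measure_ne_top _ _)).trans h1.le) (hn _)
    rw [hN0, div_zero, sub_zero, one_mul, h2, add_zero]
    rw [hFsplit, h1, add_zero] at hHarris
    exact mul_le_mul_of_nonneg_left (by linarith [hHarris]) hZpos.le
  · have hNpos : 0 < (rcMeasureW u q ∅).real N := lt_of_le_of_ne (hn N) (Ne.symm hN0)
    -- from CPA: φ(A ∩ Vv ∩ N) ≤ φ(Vv∩N) φ(A∩N)/φ(N)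
    have hc : (rcMeasureW u q ∅).real (A ∩ (Vv ∩ N)) ≤ (rcMeasureW u q ∅).real (Vv ∩ N) * (rcMeasureW u q ∅).real (A ∩ N) / (rcMeasureW u q ∅).real N := by
      rw [le_div_iff₀ hNpos]; exact hCPA
    have key : (rcMeasureW u q ∅).real (A ∩ Y) - ∑ ω, rcMass u q ω * (cp A ω * cp F ω) + (rcMeasureW u q ∅).real (A ∩ (Vv ∩ N)) ≤
        (1 - (rcMeasureW u q ∅).real (Vv ∩ N) / (rcMeasureW u q ∅).real N) * ((rcMeasureW u q ∅).real (A ∩ Y) - (rcMeasureW u q ∅).real A * (rcMeasureW u q ∅).real Y) := by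
      rw [hFsplit] at hHarris
      have hYN : (rcMeasureW u q ∅).real Y = 1 - (rcMeasureW u q ∅).real N := by linarith [hNY]
      have e : (1 - (rcMeasureW u q ∅).real (Vv ∩ N) / (rcMeasureW u q ∅).real N) * ((rcMeasureW u q ∅).real (A ∩ Y) - (rcMeasureW u q ∅).real A * (rcMeasureW u q ∅).real Y) =
          ((rcMeasureW u q ∅).real (A ∩ Y) - (rcMeasureW u q ∅).real A * (rcMeasureW u q ∅).real Y) - (rcMeasureW u q ∅).real A * (rcMeasureW u q ∅).real (Vv ∩ N) +
            ((rcMeasureW u q ∅).real (Vv ∩ N) * (rcMeasureW u q ∅).real (A ∩ N) / (rcMeasureW u q ∅).real N) := by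
        rw [hAN, hYN]; field_simp; ring
      rw [e]
      linarith [hHarris, hc]
    exact mul_le_mul_of_nonneg_left key hZpos.le


/-! ### Unconditional consequences: `T_A ≥ 0` and `Δ_N ≥ 0` for indicator test functions -/

/-- **`T_A^{FK} ≥ 0`, unconditional.**  For the random-cluster measure `φ_{w,q}` with `q ≥ 1`,
every avoided set `X` whose weight-one edges lie inside `X`, every root `z`, and every increasing
event `U` of the cluster of `s`, the hull-port functional `T_A` (the `A·b - B·a` combination of
`FKHullPortTADefs`) is nonnegative.  This is `taQ_nonneg_of_Pv` with its hypothesis `(P_v)`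
discharged by `taB_singleton_le`. [cite: Grimmett2006, Thm. (3.8), (2.17)] [cite: Gladkov2024, §2] -/
theorem taQ_nonneg_ind {q : ℝ} (hq : 1 ≤ q) (s y : V) (hsy : s ≠ y) (U : Set (Set (Sym2 V)))
    (hU : IsUpperSet U) (w : Sym2 V → unitInterval) (X : Set V)
    (hINV : ∀ p : Sym2 V, ((w p : unitInterval) : ℝ) = 1 → ∀ u ∈ p, u ∈ X) (z : V) :
    0 ≤ taQ w q s y z X (U.indicator 1) :=
  taQ_nonneg_of_Pv hq s y hsy (U.indicator 1) (KNPreFKG.monotone_indicator_one_of_isUpperSet hU)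
    (fun u v' => taB_singleton_le u hq hsy v' U hU) w X hINV z

/-- **`Δ_N^{FK} ≥ 0`, unconditional.**  The located FK lemma `(Δ)` of the lane memo (FK-Q2 §12):
for `q ≥ 1`, an avoided set `X` containing every endpoint of a weight-one edge, a fractional edge
`ab` with `a ∈ X`, and an increasing cluster event `U`,
`B(w^{ab→0}, X) · b(w^{ab→1}, X ∪ {b}) ≥ B(w^{ab→1}, X ∪ {b}) · b(w^{ab→0}, X)`.
This is `deltaN_nonneg_of_Pv` with `(P_v)` discharged by `taB_singleton_le`.
[cite: Grimmett2006, Thm. (3.8), (2.17)] [cite: Gladkov2024, §2] -/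
theorem deltaN_nonneg_ind {q : ℝ} (hq : 1 ≤ q) (s y : V) (hsy : s ≠ y) (U : Set (Set (Sym2 V)))
    (hU : IsUpperSet U) (w : Sym2 V → unitInterval) (X : Set V)
    (hINV : ∀ p : Sym2 V, ((w p : unitInterval) : ℝ) = 1 → ∀ u ∈ p, u ∈ X)
    {a b : V} (ha : a ∈ X) (hab : a ≠ b) (h0 : 0 < ((w s(a, b) : unitInterval) : ℝ))
    (h1 : ((w s(a, b) : unitInterval) : ℝ) < 1) :
    0 ≤ taB (Function.update w s(a, b) 0) q s y X (U.indicator 1) *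
          tab (Function.update w s(a, b) 1) q s y (insert b X) -
        taB (Function.update w s(a, b) 1) q s y (insert b X) (U.indicator 1) *
          tab (Function.update w s(a, b) 0) q s y X :=
  deltaN_nonneg_of_Pv hq s y hsy (U.indicator 1) (KNPreFKG.monotone_indicator_one_of_isUpperSet hU)
    (fun u v' => taB_singleton_le u hq hsy v' U hU) w X hINV ha hab h0 h1

end Summit.CriticalPhenomena.PercolationContinuityZ3.Theorems.FK

end
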